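import Summits.Ventures.YMGap.FlowData.TubeFluxSectors
import Literature.MathematicalPhysics.QuantumLattice.SU2Haar
import HarnessLib

/-!
# Venture YMGap, track Y3 FLOW-DATA — the VACUUM of the tube transfer operator carries no centre flux:
# `‖T ∘ P_0‖ = ‖T‖`, `E_0 = 0`, and the ground state is annihilated by every `P_e`, `e ≠ 0` (theorems only)

HONEST FRAMING: venture file of the cell `pub-ymgap` (QuantumFields programme), track Y3; companion THEOREMS for
`FlowData/TubeTransferOperator.lean` / `TorelonEnergy.lean` / `TubeFluxSectors.lean` (lead R237 (c)).  FLOW-PLAN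
§1.2 states «top eigenvalue `λ̂₀` simple with a positive eigenfunction in the fully symmetric sector»; this file is
its kernel form for the tube transfer operator `T = tubeTransferOperator ρ J k L` and a CENTRAL twist element `z`
(any compact second-countable `G`, continuous unitary `ρ`, any real `J`): by Jentzsch / Perron–Frobenius
(tree `IsPositivityImproving.exists_spectralGap`) there is a unit, a.e. strictly positive `φ₀` with `T φ₀ = ‖T‖ φ₀`,
unique up to scalars; since the twists `C_s` commute with `T` and preserve positivity and norm, `C_s φ₀ = φ₀`
(`exists_vacuum`), hence `P_0 φ₀ = φ₀`, `P_e φ₀ = 0` for `e ≠ 0`, **`tubeSectorNorm … 0 = ‖T‖`** and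
**`tubeFluxEnergy … 0 = 0`**: the flux energies `E_e = log ‖T‖ − log ‖T ∘ P_e‖` of `TorelonEnergy.lean` are measured
from the true ground state, which lies in the trivial flux sector.  Finite spatial torus; no number, no row,
nothing about limits or a mass gap.

References: M. Reed, B. Simon, *Methods of Modern Mathematical Physics IV* (1978) Thm. XIII.43–44
[cite: ReedSimonIV1978, §XIII.12]; G. 't Hooft, Nucl. Phys. B 153 (1979) 141 [cite: tHooft1979Flux]; M. Lüscher,
Commun. Math. Phys. 54 (1977) 283 [cite: Luscher1977].
-/

noncomputable section

open scoped BigOperators ENNReal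
open MeasureTheory Filter Function
open Literature.MathematicalPhysics.QuantumFieldTheory Literature.Analysis.OperatorTheory

namespace Summit.Ventures.YMGap.FlowData

section Characters

variable {k : ℕ}

/-- The sign character is symmetric: `χ_e(s) = χ_s(e)`. [folklore] -/
theorem fluxSign_comm (e s : Fin k → ZMod 2) : fluxSign e s = fluxSign s e := by
  unfold fluxSign
  exact Finset.prod_congr rfl fun μ _ => by simp only [and_comm]

/-- Orthogonality of characters, summed over the twist label: `Σ_s χ_e(s) = 2^k` if `e = 0`, else `0`. [folklore] -/
theorem sum_fluxSign_right (e : Fin k → ZMod 2) :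
    ∑ s : Fin k → ZMod 2, fluxSign e s = if e = 0 then (2 : ℝ) ^ k else 0 := by
  simp_rw [fluxSign_comm e]
  exact sum_fluxSign_left e

end Characters

section Vacuum

variable {G : Type*} [Group G] [TopologicalSpace G] [IsTopologicalGroup G] [CompactSpace G]
  [MeasurableSpace G] [BorelSpace G] [SecondCountableTopology G] {n : ℕ} (ρ : G →* Matrix (Fin n) (Fin n) ℂ)
  (J : ℝ) {k L : ℕ} [NeZero L]

omit [SecondCountableTopology G] in
/-- A twist of an a.e. strictly positive function is a.e. strictly positive. [folklore] -/
theorem isStrictlyPositiveFun_fluxTwistOp (z : G) (s : Fin k → ZMod 2) {φ : Lp ℝ 2 (sliceMeasure G k L)}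
    (hφ : IsStrictlyPositiveFun φ) : IsStrictlyPositiveFun (fluxTwistOp k L z s φ) := by
  unfold IsStrictlyPositiveFun at hφ ⊢
  have h1 := (measurePreserving_fluxTwist (L := L) z s).quasiMeasurePreserving.ae hφ
  filter_upwards [fluxTwistOp_ae_eq (L := L) z s φ, h1] with a ha hpos
  rw [ha, Function.comp_apply]
  exact hpos

/-- **The vacuum is twist invariant.**  For central `z`: there is a unit, a.e. strictly positive `φ₀` with
`T φ₀ = ‖T‖ φ₀`, every top eigenvector is a multiple of it, and `C_s φ₀ = φ₀` for every twist `s`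
(Jentzsch simplicity: `C_s φ₀` is again a positive unit top eigenvector). [cite: ReedSimonIV1978, §XIII.12] -/
theorem exists_vacuum (hρ : Continuous ρ) (hρu : ∀ g, ρ g ∈ Matrix.unitaryGroup (Fin n) ℂ) {z : G}
    (hz : z ∈ Subgroup.center G) :
    ∃ φ₀ : Lp ℝ 2 (sliceMeasure G k L), ‖φ₀‖ = 1 ∧ IsStrictlyPositiveFun φ₀ ∧
      tubeTransferOperator ρ J k L φ₀ = ‖tubeTransferOperator ρ J k L‖ • φ₀ ∧
      (∀ η, tubeTransferOperator ρ J k L η = ‖tubeTransferOperator ρ J k L‖ • η → η = (@inner ℝ _ _ φ₀ η) • φ₀) ∧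
      ∀ s : Fin k → ZMod 2, fluxTwistOp k L z s φ₀ = φ₀ := by
  set T := tubeTransferOperator ρ J k L with hT
  obtain ⟨φ₀, h1, hpos, heig, hsimple, -⟩ :=
    (isPositivityImproving_tubeTransferOperator J k L hρ).exists_spectralGap
      (isSelfAdjoint_tubeTransferOperator J k L hρ hρu) (isCompactOperator_tubeTransferOperator J k L hρ)
      (tubeTransferOperator_ne_zero J k L hρ)
  refine ⟨φ₀, h1, hpos, heig, hsimple, fun s => ?_⟩
  -- `C_s φ₀` is a top eigenvector, hence `c • φ₀`
  have hcomm : T (fluxTwistOp k L z s φ₀) = fluxTwistOp k L z s (T φ₀) := by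
    have h := congrArg (fun A => A φ₀) (fluxTwistOp_comp_tubeTransferOperator ρ J hρ hz s (k := k) (L := L))
    simpa only [ContinuousLinearMap.comp_apply] using h.symm
  have heig' : T (fluxTwistOp k L z s φ₀) = ‖T‖ • fluxTwistOp k L z s φ₀ := by
    rw [hcomm, heig, map_smul]
  set c : ℝ := @inner ℝ _ _ φ₀ (fluxTwistOp k L z s φ₀) with hc
  have hcφ : fluxTwistOp k L z s φ₀ = c • φ₀ := hsimple _ heig'
  -- `|c| = 1` (isometry) and `c > 0` (positivity), so `c = 1`
  have habs : |c| = 1 := by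
    have h := norm_fluxTwistOp_apply (L := L) z s φ₀
    rw [hcφ, norm_smul, Real.norm_eq_abs, h1, mul_one] at h
    exact h
  have hcpos : 0 < c := by
    have hsp := isStrictlyPositiveFun_fluxTwistOp (L := L) z s hpos
    unfold IsStrictlyPositiveFun at hsp hpos
    rw [hcφ] at hsp
    have hae : ∀ᵐ a ∂(sliceMeasure G k L), 0 < c := by
      filter_upwards [hsp, hpos, Lp.coeFn_smul c φ₀] with a ha hφa hsm
      rw [hsm, Pi.smul_apply, smul_eq_mul] at ha
      exact pos_of_mul_pos_left ha hφa.le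
    haveI : (ae (sliceMeasure G k L)).NeBot := ae_neBot.2 (IsProbabilityMeasure.ne_zero _)
    exact hae.exists.choose_spec
  have hc1 : c = 1 := by
    rw [abs_of_pos hcpos] at habs
    exact habs
  rw [hcφ, hc1, one_smul]

omit [SecondCountableTopology G] in
/-- **The trivial-flux projection fixes the vacuum** and **every other sector projection kills it**:
`P_e φ = 2^{−k} (Σ_s χ_e(s)) φ` for a twist-invariant `φ`. [cite: tHooft1979Flux] -/
theorem tubeFluxProjection_apply_of_invariant (z : G) {φ : Lp ℝ 2 (sliceMeasure G k L)}
    (hφ : ∀ s : Fin k → ZMod 2, fluxTwistOp k L z s φ = φ) (e : Fin k → ZMod 2) :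
    tubeFluxProjection z k L e φ = if e = 0 then φ else 0 := by
  unfold tubeFluxProjection fluxProjection
  rw [_root_.smul_apply, _root_.sum_apply]
  simp_rw [_root_.smul_apply, hφ, ← Finset.sum_smul, sum_fluxSign_right, ite_smul, zero_smul,
    smul_ite, smul_zero, smul_smul]
  have h2k : (2 : ℝ) ^ k ≠ 0 := by positivity
  rw [inv_mul_cancel₀ h2k, one_smul]

/-- **The vacuum sector carries the norm: `‖T ∘ P_0‖ = ‖T‖`** (central `z`). [cite: tHooft1979Flux] -/
theorem tubeSectorNorm_zero (hρ : Continuous ρ) (hρu : ∀ g, ρ g ∈ Matrix.unitaryGroup (Fin n) ℂ) {z : G}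
    (hz : z ∈ Subgroup.center G) :
    tubeSectorNorm ρ z J k L 0 = ‖tubeTransferOperator ρ J k L‖ := by
  refine le_antisymm (tubeSectorNorm_le_norm ρ z J k L 0) ?_
  obtain ⟨φ₀, h1, -, heig, -, hinv⟩ := exists_vacuum ρ J hρ hρu hz (k := k) (L := L)
  have hP : tubeFluxProjection z k L 0 φ₀ = φ₀ := by
    rw [tubeFluxProjection_apply_of_invariant z hinv, if_pos rfl]
  unfold tubeSectorNorm sectorNorm
  have h := ((tubeTransferOperator ρ J k L).comp (tubeFluxProjection z k L 0)).le_opNorm φ₀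
  rw [ContinuousLinearMap.comp_apply] at h
  change ‖tubeTransferOperator ρ J k L (tubeFluxProjection z k L 0 φ₀)‖ ≤ _ at h
  rw [hP, heig, norm_smul, Real.norm_eq_abs, abs_of_nonneg (norm_nonneg _), h1, mul_one, mul_one] at h
  exact h

/-- **The vacuum sector has flux energy zero: `E_0 = 0`** (central `z`). [folklore] -/
theorem tubeFluxEnergy_zero (hρ : Continuous ρ) (hρu : ∀ g, ρ g ∈ Matrix.unitaryGroup (Fin n) ℂ) {z : G}
    (hz : z ∈ Subgroup.center G) : tubeFluxEnergy ρ z J k L 0 = 0 := by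
  unfold tubeFluxEnergy fluxEnergy
  rw [show sectorNorm (tubeTransferOperator ρ J k L) (fluxTwistOp k L z) 0 = tubeSectorNorm ρ z J k L 0 from rfl,
    tubeSectorNorm_zero ρ J hρ hρu hz, sub_self]

/-- **The vacuum has no component in any non-trivial flux sector**: `P_e φ₀ = 0` for `e ≠ 0`. [cite: tHooft1979Flux] -/
theorem tubeFluxProjection_vacuum_eq_zero (hρ : Continuous ρ) (hρu : ∀ g, ρ g ∈ Matrix.unitaryGroup (Fin n) ℂ)
    {z : G} (hz : z ∈ Subgroup.center G) {e : Fin k → ZMod 2} (he : e ≠ 0) :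
    ∃ φ₀ : Lp ℝ 2 (sliceMeasure G k L), ‖φ₀‖ = 1 ∧ IsStrictlyPositiveFun φ₀ ∧
      tubeTransferOperator ρ J k L φ₀ = ‖tubeTransferOperator ρ J k L‖ • φ₀ ∧
      tubeFluxProjection z k L 0 φ₀ = φ₀ ∧ tubeFluxProjection z k L e φ₀ = 0 := by
  obtain ⟨φ₀, h1, hpos, heig, -, hinv⟩ := exists_vacuum ρ J hρ hρu hz (k := k) (L := L)
  refine ⟨φ₀, h1, hpos, heig, ?_, ?_⟩
  · rw [tubeFluxProjection_apply_of_invariant z hinv, if_pos rfl]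
  · rw [tubeFluxProjection_apply_of_invariant z hinv, if_neg he]

/-- `SU(2)`, `z = −1`: the cell's flux energies vanish in the trivial sector, `su2FluxEnergy β k L 0 = 0`, for every
real `β`. [folklore] -/
theorem su2FluxEnergy_zero (β : ℝ) (k L : ℕ) [NeZero L] : su2FluxEnergy β k L 0 = 0 := by
  haveI : SecondCountableTopology (Matrix.specialUnitaryGroup (Fin 2) ℂ) :=
    Literature.MathematicalPhysics.QuantumLattice.secondCountableTopology_su2
  exact tubeFluxEnergy_zero (Literature.MathematicalPhysics.QuantumLattice.fundamentalRep (Fin 2)) (β / 2)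
    (Literature.MathematicalPhysics.QuantumLattice.continuous_fundamentalRep (Fin 2))
    Literature.MathematicalPhysics.QuantumLattice.fundamentalRep_mem_unitaryGroup su2MinusOne_mem_center

end Vacuum

end Summit.Ventures.YMGap.FlowData
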